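import Mathlib
import Summits.ValiantsHypothesis.ValiantsHypothesis.Theorems.MatrixDescartes.Negative.MatrixDescartesFalseOfTropicalMonster

/-!
# `TropicalB` (stmt-ValiantsHypothesis-19771) — the HARD-CORE PAIR LAW: two additive registers under an ARBITRARY compatibility
# relation carry at most `|X| + |Y|·√|X|` dominant terms (the dominant pairs form a `K₂,₂`-free bipartite graph)

Helper file for the crux `Theses.KPlusLogSqLaw.TropicalB` (`--supports stmt-ValiantsHypothesis-19771 --as helper`), cell
`pub-symmetroid`, seat val-sym-trop-p5 (g5, refuter-adjacent lane).  HONEST FRAMING: a structure theorem about a SUB-FAMILY of the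
terms of an ARBITRARY design in the tree's vocabulary (`IsDominant`, `tropWeight`, `termSign`); it proves nothing about `TropicalB` in
its window and bears on neither `WeakLifting`, `MatrixDescartes` (stmt-ValiantsHypothesis-18050) nor VP ≠ VNP.

## Statement
Inside any design `(d, v, ε)` of format `(m, K)` take terms `τ x y` indexed by the states `x : α`, `y : β` of two REGISTERS (arbitrary
finite types), which are present and pairwise distinct whenever an ARBITRARY compatibility relation `R x y` holds («hard-core coupling»:
which pairs of states coexist is unrestricted), with additive weights `tropWeight d v θ (τ x y) = θ·(s₁ x + s₂ y) − (A x + B y)`.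
* `not_K22` — **the dominant compatible pairs form a `K₂,₂`-free bipartite graph**: for `x ≠ x'`, `y ≠ y'` the four pairs `(x,y)`,
  `(x,y')`, `(x',y)`, `(x',y')` are never all dominant.  (Each dominant pair beats the two others that share a state with it; the sign
  patterns of the two linear functions `u_x − u_{x'}` and `w_y − w_{y'}` at the four slopes are then incompatible.)
* `card_dominant_sq_le` — hence (Kővári–Sós–Turán double counting + Cauchy–Schwarz) the number `D` of dominant compatible pairs
  satisfies `D² ≤ |α|·(|β|² + D)`, i.e. `D ≤ |α| + |β|·√|α|` (`card_dominant_le_sqrt`), and symmetrically with `α`, `β` exchanged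
  (`card_dominant_sq_le'`).
* `card_dominant_triple_sq_le` — three additive registers `α, β, γ` under an arbitrary TERNARY compatibility: `D² ≤ |α|·((|β|·|γ|)² + D)`,
  so `D ≤ |α| + |β||γ|√|α|` — for three `N`-state registers `O(N^{5/2})`, SUB-CUBIC whatever the coupling.

## Why (located reading; numbers, not adjectives)
The cell's refuter lane reduced a super-quadratic `K = 4` family to «a hard-core triple coupling» of registers (val-sym-trop-p5 g4
ARCHITECTURE §7: smooth pairwise couplings give factor graphs of degree ≤ 2 and are quadratic, `PathCoupling.card_family_le`).  For
ADDITIVE registers this file closes that door up to the exponent `5/2 < 3`: no compatibility pattern among three `N`-state registers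
carries `N³` dominant terms.  What compatibility CAN buy is located in print: the dominant pairs are a convexly independent subset of the
Minkowski sum of the two state point sets, `Θ((|X||Y|)^{2/3} + |X| + |Y|)` at most and attained for suitable geometry (Eisenbrand–Pach–
Rothvoß–Sopher 2008; Bílka–Buchin–Fulek–Kiyomi–Okamoto–Tanigawa–Tóth 2010), `Θ(n log n)` when both state sets are convex chains (Tiwary
2014; Skomra–Thomassé 2021) — versus LINEAR for the comparability relation (`ComparabilityLinear.card_dominant_le_linear`) and
`|X| + |Y| − 1` for the complete relation (`ComparabilitySum.cross_card_le`).  The `K₂,₂` step is the upper-hull form of EPRS's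
`K₂,₃` remark. [folklore-level: Kővári–Sós–Turán 1954 for `K₂,₂`; EPRS 2008 §1]
-/

set_option linter.dupNamespace false
set_option autoImplicit false

namespace Summit.ValiantsHypothesis.ValiantsHypothesis.Theorems.KPlusLogSqLaw.HardCorePair

open Summit.ValiantsHypothesis.ValiantsHypothesis.Theorems.MatrixDescartes.Negative
open Finset

section Pair

variable {m K : ℕ} {α β : Type*} [Fintype α] [Fintype β] [DecidableEq α] [DecidableEq β]
  (d : Fin K → ℕ) (v ε : Fin m → Fin m → Fin K → ℤ)
  (τ : α → β → Equiv.Perm (Fin m) × (Fin m → Fin K)) (R : α → β → Prop)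
  (s₁ : α → ℤ) (s₂ : β → ℤ) (A : α → ℤ) (B : β → ℤ)
  (hinj : ∀ x y x' y', R x y → R x' y' → τ x y = τ x' y' → x = x' ∧ y = y')
  (hpres : ∀ x y, R x y → termSign ε (τ x y) ≠ 0)
  (hw : ∀ x y (θ : ℤ), R x y → tropWeight d v θ (τ x y) = θ * (s₁ x + s₂ y) - (A x + B y))

omit [Fintype α] [Fintype β] [DecidableEq α] [DecidableEq β] in
include hinj hpres hw in
/-- a dominant compatible pair beats every other compatible pair (explicit weights). -/
theorem weight_lt {x x' : α} {y y' : β} {θ : ℤ} (hR : R x y) (hR' : R x' y')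
    (hdom : IsDominant d v ε θ (τ x y)) (hne : ¬ (x = x' ∧ y = y')) :
    θ * (s₁ x' + s₂ y') - (A x' + B y') < θ * (s₁ x + s₂ y) - (A x + B y) := by
  have h := hdom.2 (τ x' y') ?_ (hpres x' y' hR')
  · rwa [hw x' y' θ hR', hw x y θ hR] at h
  · intro h
    obtain ⟨h1, h2⟩ := hinj _ _ _ _ hR' hR h
    exact hne ⟨h1.symm, h2.symm⟩

omit [Fintype α] [Fintype β] [DecidableEq α] [DecidableEq β] in
include hinj hpres hw in
/-- **`K₂,₂`-freeness.**  For `x ≠ x'` and `y ≠ y'` the four compatible pairs `(x,y), (x,y'), (x',y), (x',y')` are never all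
dominant (each at some integer slope). -/
theorem not_K22 {x x' : α} {y y' : β} (hx : x ≠ x') (hy : y ≠ y')
    (h₁ : R x y) (h₂ : R x y') (h₃ : R x' y) (h₄ : R x' y')
    {θ₁ θ₂ θ₃ θ₄ : ℤ} (d₁ : IsDominant d v ε θ₁ (τ x y)) (d₂ : IsDominant d v ε θ₂ (τ x y'))
    (d₃ : IsDominant d v ε θ₃ (τ x' y)) (d₄ : IsDominant d v ε θ₄ (τ x' y')) : False := by
  -- the eight comparisons between pairs sharing a state
  have u1 := weight_lt d v ε τ R s₁ s₂ A B hinj hpres hw h₁ h₃ d₁ (by rintro ⟨e, -⟩; exact hx e)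
  have w1 := weight_lt d v ε τ R s₁ s₂ A B hinj hpres hw h₁ h₂ d₁ (by rintro ⟨-, e⟩; exact hy e)
  have u2 := weight_lt d v ε τ R s₁ s₂ A B hinj hpres hw h₂ h₄ d₂ (by rintro ⟨e, -⟩; exact hx e)
  have w2 := weight_lt d v ε τ R s₁ s₂ A B hinj hpres hw h₂ h₁ d₂ (by rintro ⟨-, e⟩; exact hy e.symm)
  have u3 := weight_lt d v ε τ R s₁ s₂ A B hinj hpres hw h₃ h₁ d₃ (by rintro ⟨e, -⟩; exact hx e.symm)
  have w3 := weight_lt d v ε τ R s₁ s₂ A B hinj hpres hw h₃ h₄ d₃ (by rintro ⟨-, e⟩; exact hy e)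
  have u4 := weight_lt d v ε τ R s₁ s₂ A B hinj hpres hw h₄ h₂ d₄ (by rintro ⟨e, -⟩; exact hx e.symm)
  have w4 := weight_lt d v ε τ R s₁ s₂ A B hinj hpres hw h₄ h₃ d₄ (by rintro ⟨-, e⟩; exact hy e.symm)
  -- `δ := s₁ x − s₁ x'` has the sign of `θ₂ − θ₃` and of `θ₁ − θ₄`; `δ' := s₂ y − s₂ y'` has the sign of `θ₃ − θ₂` and of `θ₁ − θ₄`
  have e1 : (θ₂ - θ₃) * (s₁ x - s₁ x') > 0 := by nlinarith
  have e2 : (θ₁ - θ₄) * (s₁ x - s₁ x') > 0 := by nlinarith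
  have e3 : (θ₃ - θ₂) * (s₂ y - s₂ y') > 0 := by nlinarith
  have e4 : (θ₁ - θ₄) * (s₂ y - s₂ y') > 0 := by nlinarith
  rcases lt_trichotomy (s₁ x - s₁ x') 0 with hδ | hδ | hδ
  · rcases lt_trichotomy (s₂ y - s₂ y') 0 with hδ' | hδ' | hδ'
    · nlinarith
    · rw [hδ'] at e3; simp at e3
    · nlinarith
  · rw [hδ] at e1; simp at e1
  · rcases lt_trichotomy (s₂ y - s₂ y') 0 with hδ' | hδ' | hδ'
    · nlinarith
    · rw [hδ'] at e3; simp at e3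
    · nlinarith

open scoped Classical in
include hinj hpres hw in
/-- **THE HARD-CORE PAIR LAW (Kővári–Sós–Turán form).**  The number `D` of dominant compatible pairs satisfies
`D² ≤ |α| · (|β|² + D)`; in particular `D ≤ |α| + |β|·√|α|`. -/
theorem card_dominant_sq_le :
    ((Finset.univ : Finset (α × β)).filter (fun i => R i.1 i.2 ∧ ∃ θ : ℤ, IsDominant d v ε θ (τ i.1 i.2))).card ^ 2 ≤
      Fintype.card α * (Fintype.card β ^ 2 +
        ((Finset.univ : Finset (α × β)).filter (fun i => R i.1 i.2 ∧ ∃ θ : ℤ, IsDominant d v ε θ (τ i.1 i.2))).card) := by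
  classical
  set Dset := (Finset.univ : Finset (α × β)).filter (fun i => R i.1 i.2 ∧ ∃ θ : ℤ, IsDominant d v ε θ (τ i.1 i.2)) with hDset
  have hmemD : ∀ i, i ∈ Dset ↔ R i.1 i.2 ∧ ∃ θ : ℤ, IsDominant d v ε θ (τ i.1 i.2) := fun i => by
    rw [hDset, Finset.mem_filter]; simp
  -- neighbourhoods
  let Nb : α → Finset β := fun x => (Finset.univ : Finset β).filter (fun y => (x, y) ∈ Dset)
  have hmemNb : ∀ x y, y ∈ Nb x ↔ (x, y) ∈ Dset := fun x y => by simp [Nb]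
  -- `D = Σ_x |Nb x|`
  have hD : Dset.card = ∑ x : α, (Nb x).card := by
    rw [Finset.card_eq_sum_card_fiberwise (f := Prod.fst) (t := (Finset.univ : Finset α))
      (fun i _ => Finset.mem_coe.2 (Finset.mem_univ _))]
    refine Finset.sum_congr rfl fun x _ => ?_
    refine Finset.card_bij' (fun i _ => i.2) (fun y _ => (x, y)) ?_ ?_ ?_ ?_
    · intro i hi
      obtain ⟨hiD, hix⟩ := Finset.mem_filter.1 hi
      rw [hmemNb, ← hix]; exact hiD
    · intro y hy
      rw [hmemNb] at hy
      exact Finset.mem_filter.2 ⟨hy, rfl⟩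
    · intro i hi
      obtain ⟨-, hix⟩ := Finset.mem_filter.1 hi
      exact Prod.ext hix.symm rfl
    · intro y _; rfl
  -- `K₂,₂`-freeness: two distinct `x` share at most one neighbour
  have hK22 : ∀ x x', x ≠ x' → (Nb x ∩ Nb x').card ≤ 1 := by
    intro x x' hxx'
    refine Finset.card_le_one.2 fun y hy y' hy' => ?_
    by_contra hyy'
    obtain ⟨hy1, hy2⟩ := Finset.mem_inter.1 hy
    obtain ⟨hy'1, hy'2⟩ := Finset.mem_inter.1 hy'
    rw [hmemNb, hmemD] at hy1 hy2 hy'1 hy'2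
    obtain ⟨r1, θ₁, d₁⟩ := hy1
    obtain ⟨r3, θ₃, d₃⟩ := hy2
    obtain ⟨r2, θ₂, d₂⟩ := hy'1
    obtain ⟨r4, θ₄, d₄⟩ := hy'2
    exact not_K22 d v ε τ R s₁ s₂ A B hinj hpres hw hxx' hyy' r1 r2 r3 r4 d₁ d₂ d₃ d₄
  -- double counting of ordered pairs of distinct neighbours: `Σ_x |Nb x|(|Nb x| − 1) ≤ |β|(|β| − 1)`
  have hpairs : ∑ x : α, ((Nb x).card * ((Nb x).card - 1)) ≤ Fintype.card β * (Fintype.card β - 1) := by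
    -- the map `x ↦ offDiag (Nb x)` has pairwise disjoint images inside `offDiag univ`
    have hdisj : ∀ x ∈ (Finset.univ : Finset α), ∀ x' ∈ (Finset.univ : Finset α), x ≠ x' →
        Disjoint ((Nb x).offDiag) ((Nb x').offDiag) := by
      intro x _ x' _ hxx'
      rw [Finset.disjoint_left]
      intro q hq hq'
      rw [Finset.mem_offDiag] at hq hq'
      have h2 : 2 ≤ (Nb x ∩ Nb x').card := by
        have hsub : ({q.1, q.2} : Finset β) ⊆ Nb x ∩ Nb x' := by
          intro z hz
          rw [Finset.mem_insert, Finset.mem_singleton] at hz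
          rcases hz with rfl | rfl
          · exact Finset.mem_inter.2 ⟨hq.1, hq'.1⟩
          · exact Finset.mem_inter.2 ⟨hq.2.1, hq'.2.1⟩
        have := Finset.card_le_card hsub
        rwa [Finset.card_pair hq.2.2] at this
      have h1 := hK22 x x' hxx'
      omega
    have hcard := Finset.card_biUnion hdisj
    have hsub : (Finset.univ : Finset α).biUnion (fun x => (Nb x).offDiag) ⊆ (Finset.univ : Finset β).offDiag := by
      intro q hq
      obtain ⟨x, -, hx⟩ := Finset.mem_biUnion.1 hq
      rw [Finset.mem_offDiag] at hx ⊢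
      exact ⟨Finset.mem_univ _, Finset.mem_univ _, hx.2.2⟩
    have hle := Finset.card_le_card hsub
    rw [hcard, Finset.offDiag_card, Finset.card_univ] at hle
    calc ∑ x : α, (Nb x).card * ((Nb x).card - 1) = ∑ x : α, ((Nb x).offDiag).card := by
          refine Finset.sum_congr rfl fun x _ => ?_
          rw [Finset.offDiag_card, Nat.mul_sub_one]
      _ ≤ Fintype.card β * Fintype.card β - Fintype.card β := hle
      _ = Fintype.card β * (Fintype.card β - 1) := by rw [Nat.mul_sub_one]
  -- Cauchy–Schwarz: `(Σ |Nb x|)² ≤ |α| · Σ |Nb x|²`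
  have hCS : (∑ x : α, (Nb x).card) ^ 2 ≤ Fintype.card α * ∑ x : α, (Nb x).card ^ 2 := by
    have h := sq_sum_le_card_mul_sum_sq (s := (Finset.univ : Finset α)) (f := fun x => (Nb x).card)
    simpa [Finset.card_univ] using h
  -- assemble: `Σ |Nb x|² = Σ |Nb x|(|Nb x| − 1) + Σ |Nb x|`
  have hsq : ∑ x : α, (Nb x).card ^ 2 = ∑ x : α, ((Nb x).card * ((Nb x).card - 1)) + ∑ x : α, (Nb x).card := by
    rw [← Finset.sum_add_distrib]
    refine Finset.sum_congr rfl fun x _ => ?_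
    rcases Nat.eq_zero_or_pos (Nb x).card with h0 | hpos
    · simp [h0]
    · rw [Nat.pow_two, Nat.mul_sub_one]
      have : (Nb x).card ≤ (Nb x).card * (Nb x).card := Nat.le_mul_self _
      omega
  rw [hD]
  calc (∑ x : α, (Nb x).card) ^ 2 ≤ Fintype.card α * ∑ x : α, (Nb x).card ^ 2 := hCS
    _ = Fintype.card α * (∑ x : α, ((Nb x).card * ((Nb x).card - 1)) + ∑ x : α, (Nb x).card) := by rw [hsq]
    _ ≤ Fintype.card α * (Fintype.card β * (Fintype.card β - 1) + ∑ x : α, (Nb x).card) :=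
        Nat.mul_le_mul_left _ (Nat.add_le_add_right hpairs _)
    _ ≤ Fintype.card α * (Fintype.card β ^ 2 + ∑ x : α, (Nb x).card) := by
        apply Nat.mul_le_mul_left
        apply Nat.add_le_add_right
        rw [Nat.pow_two]
        exact Nat.mul_le_mul_left _ (Nat.sub_le _ _)

end Pair

section Consequences

variable {m K : ℕ} {α β γ : Type*} [Fintype α] [Fintype β] [Fintype γ] [DecidableEq α] [DecidableEq β] [DecidableEq γ]
  (d : Fin K → ℕ) (v ε : Fin m → Fin m → Fin K → ℤ)

/-- the elementary square-root extraction: `D² ≤ a·(b² + D)` forces `D ≤ a + b·(√a + 1)` (`√` = `Nat.sqrt`). -/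
theorem le_of_sq_le (D a b : ℕ) (h : D ^ 2 ≤ a * (b ^ 2 + D)) : D ≤ a + b * (Nat.sqrt a + 1) := by
  by_contra hlt
  push Not at hlt
  set r := Nat.sqrt a with hr
  have hr1 : a < (r + 1) ^ 2 := Nat.lt_succ_sqrt' a
  have hD : a + b * (r + 1) + 1 ≤ D := hlt
  -- over `ℤ`: `D (D − a) ≥ T (T − a) > a b²` for `T = a + b(r+1) + 1`, contradicting `D² ≤ a b² + a D`
  have h' : ((D : ℤ)) ^ 2 ≤ (a : ℤ) * ((b : ℤ) ^ 2 + (D : ℤ)) := by exact_mod_cast h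
  have hr1' : (a : ℤ) < ((r : ℤ) + 1) ^ 2 := by exact_mod_cast hr1
  have hD' : (a : ℤ) + (b : ℤ) * ((r : ℤ) + 1) + 1 ≤ (D : ℤ) := by exact_mod_cast hD
  have hb : (0 : ℤ) ≤ (b : ℤ) := by exact_mod_cast Nat.zero_le b
  have ha : (0 : ℤ) ≤ (a : ℤ) := by exact_mod_cast Nat.zero_le a
  have hr : (0 : ℤ) ≤ (r : ℤ) := by exact_mod_cast Nat.zero_le r
  have p1 : 0 ≤ ((D : ℤ) - ((a : ℤ) + (b : ℤ) * ((r : ℤ) + 1) + 1)) *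
      ((D : ℤ) + ((a : ℤ) + (b : ℤ) * ((r : ℤ) + 1) + 1) - (a : ℤ)) :=
    mul_nonneg (by linarith) (by nlinarith)
  have p2 : 0 ≤ ((b : ℤ)) ^ 2 * ((((r : ℤ) + 1) ^ 2) - (a : ℤ) - 1) :=
    mul_nonneg (sq_nonneg _) (by linarith)
  have p3 : (0 : ℤ) ≤ (a : ℤ) * (b : ℤ) * (r : ℤ) := mul_nonneg (mul_nonneg ha hb) hr
  have p4 : (0 : ℤ) ≤ (a : ℤ) * (b : ℤ) := mul_nonneg ha hb
  have p5 : (0 : ℤ) ≤ (b : ℤ) * (r : ℤ) := mul_nonneg hb hr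
  have p6 : (0 : ℤ) ≤ (b : ℤ) ^ 2 := sq_nonneg _
  linarith [p1, p2, h', p3, p4, p5, p6, hb, ha, hr]

open scoped Classical in
/-- **HARD-CORE PAIR LAW, readable form**: `D ≤ |α| + |β|·(√|α| + 1)` dominant compatible pairs. -/
theorem card_dominant_le_sqrt
    (τ : α → β → Equiv.Perm (Fin m) × (Fin m → Fin K)) (R : α → β → Prop)
    (s₁ : α → ℤ) (s₂ : β → ℤ) (A : α → ℤ) (B : β → ℤ)
    (hinj : ∀ x y x' y', R x y → R x' y' → τ x y = τ x' y' → x = x' ∧ y = y')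
    (hpres : ∀ x y, R x y → termSign ε (τ x y) ≠ 0)
    (hw : ∀ x y (θ : ℤ), R x y → tropWeight d v θ (τ x y) = θ * (s₁ x + s₂ y) - (A x + B y)) :
    ((Finset.univ : Finset (α × β)).filter (fun i => R i.1 i.2 ∧ ∃ θ : ℤ, IsDominant d v ε θ (τ i.1 i.2))).card ≤
      Fintype.card α + Fintype.card β * (Nat.sqrt (Fintype.card α) + 1) :=
  le_of_sq_le _ _ _ (card_dominant_sq_le d v ε τ R s₁ s₂ A B hinj hpres hw)

open scoped Classical in
/-- **the symmetric form** (`α` and `β` exchanged): `D² ≤ |β|·(|α|² + D)`. -/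
theorem card_dominant_sq_le'
    (τ : α → β → Equiv.Perm (Fin m) × (Fin m → Fin K)) (R : α → β → Prop)
    (s₁ : α → ℤ) (s₂ : β → ℤ) (A : α → ℤ) (B : β → ℤ)
    (hinj : ∀ x y x' y', R x y → R x' y' → τ x y = τ x' y' → x = x' ∧ y = y')
    (hpres : ∀ x y, R x y → termSign ε (τ x y) ≠ 0)
    (hw : ∀ x y (θ : ℤ), R x y → tropWeight d v θ (τ x y) = θ * (s₁ x + s₂ y) - (A x + B y)) :
    ((Finset.univ : Finset (α × β)).filter (fun i => R i.1 i.2 ∧ ∃ θ : ℤ, IsDominant d v ε θ (τ i.1 i.2))).card ^ 2 ≤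
      Fintype.card β * (Fintype.card α ^ 2 +
        ((Finset.univ : Finset (α × β)).filter (fun i => R i.1 i.2 ∧ ∃ θ : ℤ, IsDominant d v ε θ (τ i.1 i.2))).card) := by
  classical
  -- apply the law to the transposed family
  have h := card_dominant_sq_le d v ε (fun y x => τ x y) (fun y x => R x y) s₂ s₁ B A
    (fun y x y' x' h1 h2 h3 => by
      obtain ⟨e1, e2⟩ := hinj x y x' y' h1 h2 h3
      exact ⟨e2, e1⟩)
    (fun y x h1 => hpres x y h1)
    (fun y x θ h1 => by rw [hw x y θ h1]; ring)
  -- the transposed count equals the original count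
  have hcard : ((Finset.univ : Finset (β × α)).filter (fun i => R i.2 i.1 ∧ ∃ θ : ℤ, IsDominant d v ε θ (τ i.2 i.1))).card =
      ((Finset.univ : Finset (α × β)).filter (fun i => R i.1 i.2 ∧ ∃ θ : ℤ, IsDominant d v ε θ (τ i.1 i.2))).card := by
    refine Finset.card_bij' (fun i _ => (i.2, i.1)) (fun i _ => (i.2, i.1)) ?_ ?_ ?_ ?_
    · intro i hi
      simp only [Finset.mem_filter, Finset.mem_univ, true_and] at hi ⊢
      exact hi
    · intro i hi
      simp only [Finset.mem_filter, Finset.mem_univ, true_and] at hi ⊢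
      exact hi
    · intro i _; rfl
    · intro i _; rfl
  rw [hcard] at h
  exact h

open scoped Classical in
/-- **THREE REGISTERS, ANY TERNARY COMPATIBILITY: sub-cubic.**  Terms `τ x y z` (`x : α`, `y : β`, `z : γ`), present and pairwise
distinct whenever `R x y z`, with additive weights `θ·(s₁ x + s₂ y + s₃ z) − (A x + B y + C z)`: the number `D` of dominant compatible
triples satisfies `D² ≤ |α|·((|β|·|γ|)² + D)`, i.e. `D ≤ |α| + |β||γ|√|α|` — `O(N^{5/2})` for three `N`-state registers. -/
theorem card_dominant_triple_sq_le
    (τ : α → β → γ → Equiv.Perm (Fin m) × (Fin m → Fin K)) (R : α → β → γ → Prop)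
    (s₁ : α → ℤ) (s₂ : β → ℤ) (s₃ : γ → ℤ) (A : α → ℤ) (B : β → ℤ) (C : γ → ℤ)
    (hinj : ∀ x y z x' y' z', R x y z → R x' y' z' → τ x y z = τ x' y' z' → x = x' ∧ y = y' ∧ z = z')
    (hpres : ∀ x y z, R x y z → termSign ε (τ x y z) ≠ 0)
    (hw : ∀ x y z (θ : ℤ), R x y z → tropWeight d v θ (τ x y z) = θ * (s₁ x + s₂ y + s₃ z) - (A x + B y + C z)) :
    ((Finset.univ : Finset (α × (β × γ))).filter
        (fun i => R i.1 i.2.1 i.2.2 ∧ ∃ θ : ℤ, IsDominant d v ε θ (τ i.1 i.2.1 i.2.2))).card ^ 2 ≤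
      Fintype.card α * ((Fintype.card β * Fintype.card γ) ^ 2 +
        ((Finset.univ : Finset (α × (β × γ))).filter
          (fun i => R i.1 i.2.1 i.2.2 ∧ ∃ θ : ℤ, IsDominant d v ε θ (τ i.1 i.2.1 i.2.2))).card) := by
  classical
  have h := card_dominant_sq_le d v ε (fun x (q : β × γ) => τ x q.1 q.2) (fun x q => R x q.1 q.2)
    s₁ (fun q => s₂ q.1 + s₃ q.2) A (fun q => B q.1 + C q.2)
    (fun x q x' q' h1 h2 h3 => by
      obtain ⟨e1, e2, e3⟩ := hinj _ _ _ _ _ _ h1 h2 h3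
      exact ⟨e1, Prod.ext e2 e3⟩)
    (fun x q h1 => hpres x q.1 q.2 h1)
    (fun x q θ h1 => by rw [hw x q.1 q.2 θ h1]; ring)
  rw [Fintype.card_prod] at h
  exact h

end Consequences

end Summit.ValiantsHypothesis.ValiantsHypothesis.Theorems.KPlusLogSqLaw.HardCorePair
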